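import Mathlib
import HarnessLib
import Summits.HubbardSuperconductivity.HubbardSuperconductivity.Theorems.KLProgrammeKLRegimeBetaSplitV17F2
import Summits.HubbardSuperconductivity.HubbardSuperconductivity.Theorems.KLProgrammeKLRegimeBetaSplitEdgeFVariation

/-!
# Route `KLProgramme` — crux K3 gen 8, CHILD 1 (stmt-HubbardSuperconductivity-20438) at SLOT level with the split slot allowed to carry (B1-V):
# `betaSplitP_of_slotsV17F2_variation` (split ⇐ `BetaSplitAtV17F ∧ (B1-V)`, engine ⇒ `EngineBoundsAtV17F2`, renorm ⇒ `FlowPieceJetsAt`)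

Cell gate-hubbard-kl, seat hubbard-kl-k3c1-p1 (g19; child-1 lineage; technique «composed-map remainder propagation»).  Pen g25 (R372)(B)/(R379)(B), located risk #14
«S3 IN U-CURRENCY».  This is `betaSplitP_of_slotsV17F2` (`…BetaSplitV17F2`) VERBATIM — extra family `thermalBar + legDressBarQ2·(count at the running frame) + (Klam U)²(ph gains)⁺
+ frameShiftBar`, numerals `(sG, sQ, tG, tQ, tN) = (3, 9, 10/3, 148/3, 15)`, sign-defect allowance `2·klEdge`, `uR R = klE0/(32·Gfr₀+1)`, proof adapted from that file —
over `betaSplitP_of_edgeClausesF_variation` (`…BetaSplitEdgeFVariation`) instead of `betaSplitP_of_edgeClausesF`: the slot hypothesis `hs` may use, besides `BetaSplitAtV17F … n`,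
the package **(B1-V)** (per `Qm` ONE comparison sequence `u`, `W`, `m`: exact repulsive Riccati law, `|W i| ≤ m i ≤ bhi`, in-class sign defect
`m i − W i ≤ 2·klEdge G (i+1) |Qm|_𝕋`, `W = m = 0` past the class exit or past `n`, `16·U·Σ(m − W) ≤ 1`, quasi-monotonicity, `Σ_{i<n}|u (i+1) − u i| ≤ (257/225)·U`, the (B1-F)
envelope at EVERY `j ≤ n`, and `Σ_{i<n}‖𝒞_{i+1}[K_{i+1}](Qm;k,k′) − 𝒞_i[K_i](Qm;k,k′)‖ ≤ (11/9)·U + (C_W + klLegKappa·CR·Klam³)·U²` on `klBall L μ 0`).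
**`betaSplitP_of_slotsV17F2_variation`**: for EVERY bundle `Pr` with `BetaSplitAtV17F ∧ (B1-V) ⇒ Pr.split`, `Pr.engine ⇒ EngineBoundsAtV17F2`, `Pr.renorm ⇒ FlowPieceJetsAt`:
`BetaSplitP Pr W` — i.e. a bundle whose split slot is re-keyed to `BetaSplitAtV17F ∧ (B1-V)` (a planner's motion, not made here) has its child 1 closed by this one call, and an
engine-side consumer of the history may then read (B1-V) at every `j < n`.  The registered bundle `klPredsV17F2` (split = `BetaSplitAtV17F`) is the special case
`betaSplitP_klPredsV17F2`.  Nothing registered moves; nothing about the model is asserted; nothing asserts superconductivity.  Everything is proved; no definitions.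
-/

noncomputable section

namespace Summit.HubbardSuperconductivity.HubbardSuperconductivity.Theorems.KLRegimeSplit

set_option linter.dupNamespace false -- summit = problem name (single-conjunct summit), D-0017

open Real Finset Literature.MathematicalPhysics.QuantumLattice Literature.Probability.LatticeModels
open Summit.HubbardSuperconductivity.HubbardSuperconductivity.Theorems.KLProgrammeLegKernels
open Summit.HubbardSuperconductivity.HubbardSuperconductivity.Theorems.CooperChannelRiccatiFlow
open Summit.HubbardSuperconductivity.HubbardSuperconductivity.Theorems.DispersionFlow

section Model

/-- **Child 1 at slot level with the split slot allowed to carry (B1-V)** — twin of `betaSplitP_of_slotsV17F2` (same extra family, numerals, allowance, proof); see the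
module docstring for the (B1-V) package handed to `hs`. -/
theorem betaSplitP_of_slotsV17F2_variation {Pr : Preds} {W : Set ℝ}
    (hs : ∀ (L M : ℕ) [NeZero L] [NeZero M] (G : GeoConsts) (P : SplitConsts) (Q : EngConsts) (β U μ : ℝ) (K : TrigPolyC4v) (n : ℕ),
      BetaSplitAtV17F L M G P Q β U μ n →
      (∀ Qm : TorusSite 2 L, ∃ u W m : ℕ → ℝ, u 0 = U ∧ (∀ i, u (i + 1) = u i / (1 + W i * u i)) ∧
        (∀ i, |W i| ≤ m i ∧ m i ≤ G.bhi) ∧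
        (∀ i < n, IsPairClassAt L Qm (i + 1) → m i - W i ≤ 2 * klEdge G (i + 1) (klTorusNorm L Qm)) ∧
        (∀ i, (n ≤ i ∨ ¬ IsPairClassAt L Qm (i + 1)) → W i = 0 ∧ m i = 0) ∧
        16 * U * ∑ i ∈ range n, (m i - W i) ≤ 1 ∧
        (∀ i j, i ≤ j → j ≤ n → u j ≤ u i + (16 / 15 * U) ^ 2 * ∑ l ∈ Ico i j, (m l - W l)) ∧
        ∑ i ∈ range n, |u (i + 1) - u i| ≤ 257 / 225 * U ∧
        (∀ j ≤ n, 0 ≤ u j ∧ u j ≤ 2 * |U| ∧ ∀ k ∈ klBall L μ 0, ∀ k' ∈ klBall L μ 0,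
          ‖klPairAmplitude L M β U μ (klFlowFrameU L M β U μ j) j Qm k k' - (u j : ℂ)‖ ≤ (P.C_W + klLegKappa * Q.CR * P.Klam ^ 3) * U ^ 2) ∧
        ∀ k ∈ klBall L μ 0, ∀ k' ∈ klBall L μ 0,
          ∑ i ∈ range n, ‖klPairAmplitude L M β U μ (klFlowFrameU L M β U μ (i + 1)) (i + 1) Qm k k' -
              klPairAmplitude L M β U μ (klFlowFrameU L M β U μ i) i Qm k k'‖ ≤
            11 / 9 * U + (P.C_W + klLegKappa * Q.CR * P.Klam ^ 3) * U ^ 2) →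
      Pr.split L M G P Q β U μ K n)
    (he : ∀ (L M : ℕ) [NeZero L] [NeZero M] (G : GeoConsts) (P : SplitConsts) (Q : EngConsts) (β U μ : ℝ) (K : TrigPolyC4v) (n : ℕ),
      Pr.engine L M G P Q β U μ K n → EngineBoundsAtV17F2 L M G P Q β U μ n)
    (hr : ∀ (L M : ℕ) [NeZero L] [NeZero M] (β U μ : ℝ) (K : TrigPolyC4v) (R : RenConsts) (n : ℕ),
      Pr.renorm L M β U μ K R n → FlowPieceJetsAt L M β U μ R n) :
    BetaSplitP Pr W := by
  refine betaSplitP_of_edgeClausesF_variation (Pr := Pr) (sG := 3) (sQ := 9) (tG := 10 / 3) (tQ := 148 / 3) (tN := 15) (by norm_num) (by norm_num)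
    (by norm_num) (by norm_num) (by norm_num) (by unfold klLegKappa; norm_num)
    (fun R => klE0 / (32 * R.Gfr 0 + 1)) (fun R hR => div_pos (by norm_num [klE0]) (by linarith [hR.2.2 0]))
    (fun L M _ _ G P Q β U μ j Qm k k' =>
      if 1 ≤ j then thermalBar G P U β j + legDressBarQ2 G P Q U j (legSliceCountT L β μ (klFlowFrameU L M β U μ j) j ![k', Qm - k', Qm - k, k]) +
        (P.Klam * U) ^ 2 * (max (G.phGain j (klTorusNorm L (k - k'))) 0 + max (G.phGain j (klTorusNorm L (k + k' - Qm))) 0) +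
        frameShiftBar P Q U j
      else legDressBarQ2 G P Q U 0 4)
    ?_ ?_ ?_ ?_ (fun L G P Q β U μ j Qm => 2 * klEdge G j (klTorusNorm L Qm)) ?_ hs ?_
  · -- nonnegativity
    intro L M _ _ G P Q β U μ j Qm k k' hG hP hQ
    have hCF : 0 ≤ G.CF := hG.2.2.2.2.2.2.2.2.2.2.2.2.2.1
    have hK0 : 0 ≤ P.Klam := zero_le_one.trans hP.1
    split_ifs
    · exact add_nonneg (add_nonneg (add_nonneg (thermalBar_nonneg hCF P U β j) (legDressBarQ2_nonneg G hK0 hQ.2.1 U j _))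
        (klbs9_X_nonneg G P U j _ _)) (frameShiftBar_nonneg hQ.2.1 U j)
    · exact legDressBarQ2_nonneg G hK0 hQ.2.1 U 0 _
  · -- per-scale size (`≤ 3·CF(Klam U)² + 9·CR·Klam³·U²`)
    intro L M _ _ G P Q β U μ j Qm k k' hG hP hQ hU hU1
    have hCF : 0 ≤ G.CF := hG.2.2.2.2.2.2.2.2.2.2.2.2.2.1
    have hK0 : 0 ≤ P.Klam := zero_le_one.trans hP.1
    have hCR : 0 ≤ Q.CR := hQ.2.1
    have hcr3 := cr3_le hP.1 hCR hU1
    have hq30 : 0 ≤ Q.CR * P.Klam ^ 3 * U ^ 2 := by positivity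
    have hg20 : 0 ≤ G.CF * (P.Klam * U) ^ 2 := by positivity
    split_ifs with hj
    · have h1 := thermalBar_le hCF P U β j
      have h2 := legDressBarQ2_le G hK0 hCR U j (legSliceCountT L β μ (klFlowFrameU L M β U μ j) j ![k', Qm - k', Qm - k, k])
      have h4 : (legSliceCountT L β μ (klFlowFrameU L M β U μ j) j ![k', Qm - k', Qm - k, k] : ℝ) ≤ 4 := by
        exact_mod_cast legSliceCountT_le_four L β μ (klFlowFrameU L M β U μ j) j _
      have h3 : Q.CR * ((P.Klam * U) ^ 2 + (P.Klam * |U|) ^ 3) * (legSliceCountT L β μ (klFlowFrameU L M β U μ j) j ![k', Qm - k', Qm - k, k] : ℝ) ≤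
          2 * Q.CR * P.Klam ^ 3 * U ^ 2 * 4 := mul_le_mul hcr3 h4 (Nat.cast_nonneg _) (by positivity)
      have h5 : (P.Klam * U) ^ 2 * (max (G.phGain j (klTorusNorm L (k - k'))) 0 + max (G.phGain j (klTorusNorm L (k + k' - Qm))) 0) ≤
          2 * (G.CF * (P.Klam * U) ^ 2) := klbs9_X_le hG P U j (torusSupNorm_nonneg _) (torusSupNorm_nonneg _)
      have h6 := frameShiftBar_le_cube hP.1 hCR U j
      linarith
    · have h2 := legDressBarQ2_le G hK0 hCR U 0 4
      have h3 : Q.CR * ((P.Klam * U) ^ 2 + (P.Klam * |U|) ^ 3) * ((4 : ℕ) : ℝ) ≤ 2 * Q.CR * P.Klam ^ 3 * U ^ 2 * 4 := by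
        rw [Nat.cast_ofNat]; nlinarith [hcr3]
      linarith
  · -- scale sums over `(t, n]`: the (D) count is summed along the flow frames with the rate read from the history below `n`
    intro L M _ _ G P Q R β U μ K t n Qm k k' hG hP hQ hR hU hU1 hUR hn hHist
    have hCF : 0 ≤ G.CF := hG.2.2.2.2.2.2.2.2.2.2.2.2.2.1
    have hK0 : 0 ≤ P.Klam := zero_le_one.trans hP.1
    have hCR : 0 ≤ Q.CR := hQ.2.1
    have hcr3 := cr3_le hP.1 hCR hU1
    have hq30 : 0 ≤ Q.CR * P.Klam ^ 3 * U ^ 2 := by positivity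
    have hGfr : 0 ≤ R.Gfr 0 := hR.2.2 0
    have hU32 : 32 * R.Gfr 0 * |U| ≤ klE0 := klbsF_rate_smallness hU hGfr hUR
    have hJ : ∀ m < n, FlowPieceJetsAt L M β U μ R m := fun m hm => hr L M β U μ K R m (hHist m hm).2.1
    have heq : ∀ j ∈ Ioc t n, (if 1 ≤ j then thermalBar G P U β j +
        legDressBarQ2 G P Q U j (legSliceCountT L β μ (klFlowFrameU L M β U μ j) j ![k', Qm - k', Qm - k, k]) +
        (P.Klam * U) ^ 2 * (max (G.phGain j (klTorusNorm L (k - k'))) 0 + max (G.phGain j (klTorusNorm L (k + k' - Qm))) 0) +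
        frameShiftBar P Q U j
        else legDressBarQ2 G P Q U 0 4) =
        thermalBar G P U β j + legDressBarQ2 G P Q U j (legSliceCountT L β μ (klFlowFrameU L M β U μ j) j ![k', Qm - k', Qm - k, k]) +
        (P.Klam * U) ^ 2 * (max (G.phGain j (klTorusNorm L (k - k'))) 0 + max (G.phGain j (klTorusNorm L (k + k' - Qm))) 0) +
        frameShiftBar P Q U j := by
      intro j hj
      simp only [mem_Ioc] at hj
      rw [if_pos (by omega)]
    rw [sum_congr rfl heq, sum_add_distrib, sum_add_distrib, sum_add_distrib]
    have hsub : ∀ (f : ℕ → ℝ), (∀ j, 0 ≤ f j) → ∑ j ∈ Ioc t n, f j ≤ ∑ j ∈ range (n + 1), f j := fun f hf =>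
      sum_le_sum_of_subset_of_nonneg (fun j hj => by simp only [mem_Ioc] at hj; exact mem_range.2 (by omega)) fun j _ _ => hf j
    have h1 : ∑ j ∈ Ioc t n, thermalBar G P U β j ≤ 4 / 3 * (G.CF * (P.Klam * U) ^ 2) :=
      (hsub _ fun j => thermalBar_nonneg hCF P U β j).trans (thermalBar_sum_le hCF P U β hn)
    have h2 : ∑ j ∈ Ioc t n, legDressBarQ2 G P Q U j (legSliceCountT L β μ (klFlowFrameU L M β U μ j) j ![k', Qm - k', Qm - k, k]) ≤
        20 * (2 * Q.CR * P.Klam ^ 3 * U ^ 2) :=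
      ((hsub _ fun j => legDressBarQ2_nonneg G hK0 hCR U j _).trans
          (legDressBarQ2_countT_flowFrameU_sum_le L M G hK0 hCR hJ hGfr hU32 _)).trans (by nlinarith [hcr3])
    have h3 : ∑ j ∈ Ioc t n, (P.Klam * U) ^ 2 * (max (G.phGain j (klTorusNorm L (k - k'))) 0 + max (G.phGain j (klTorusNorm L (k + k' - Qm))) 0) ≤
        2 * (G.CF * (P.Klam * U) ^ 2) :=
      (hsub _ fun j => klbs9_X_nonneg G P U j _ _).trans
        (klbs9_X_sum_le hG P U (n + 1) (torusSupNorm_nonneg _) (torusSupNorm_nonneg _))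
    have h4 : ∑ j ∈ Ioc t n, frameShiftBar P Q U j ≤ 4 / 3 * (Q.CR * P.Klam ^ 3 * U ^ 2) :=
      (hsub _ fun j => frameShiftBar_nonneg hCR U j).trans (sum_frameShiftBar_le_cube' hP.1 hCR U (n + 1))
    linarith
  · -- scale sums `m ≤ n`: the scale-0 term plus the shifted inductive sums
    intro L M _ _ G P Q R β U μ K n Qm k k' hG hP hQ hR hU hU1 hUR hn hHist
    have hCF : 0 ≤ G.CF := hG.2.2.2.2.2.2.2.2.2.2.2.2.2.1
    have hK0 : 0 ≤ P.Klam := zero_le_one.trans hP.1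
    have hCR : 0 ≤ Q.CR := hQ.2.1
    have hcr3 := cr3_le hP.1 hCR hU1
    have hq30 : 0 ≤ Q.CR * P.Klam ^ 3 * U ^ 2 := by positivity
    have hGfr : 0 ≤ R.Gfr 0 := hR.2.2 0
    have hU32 : 32 * R.Gfr 0 * |U| ≤ klE0 := klbsF_rate_smallness hU hGfr hUR
    have hJ : ∀ m < n, FlowPieceJetsAt L M β U μ R m := fun m hm => hr L M β U μ K R m (hHist m hm).2.1
    have heq : ∀ i ∈ range n, (if 1 ≤ i + 1 then thermalBar G P U β (i + 1) +
        legDressBarQ2 G P Q U (i + 1) (legSliceCountT L β μ (klFlowFrameU L M β U μ (i + 1)) (i + 1) ![k', Qm - k', Qm - k, k]) +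
        (P.Klam * U) ^ 2 * (max (G.phGain (i + 1) (klTorusNorm L (k - k'))) 0 + max (G.phGain (i + 1) (klTorusNorm L (k + k' - Qm))) 0) +
        frameShiftBar P Q U (i + 1)
        else legDressBarQ2 G P Q U 0 4) =
        thermalBar G P U β (i + 1) +
        legDressBarQ2 G P Q U (i + 1) (legSliceCountT L β μ (klFlowFrameU L M β U μ (i + 1)) (i + 1) ![k', Qm - k', Qm - k, k]) +
        (P.Klam * U) ^ 2 * (max (G.phGain (i + 1) (klTorusNorm L (k - k'))) 0 + max (G.phGain (i + 1) (klTorusNorm L (k + k' - Qm))) 0) +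
        frameShiftBar P Q U (i + 1) :=
      fun i _ => by rw [if_pos (by omega)]
    rw [if_neg (by omega), sum_congr rfl heq, sum_add_distrib, sum_add_distrib, sum_add_distrib]
    have h0 := legDressBarQ2_le G hK0 hCR U 0 4
    have h0' : Q.CR * ((P.Klam * U) ^ 2 + (P.Klam * |U|) ^ 3) * ((4 : ℕ) : ℝ) ≤ 2 * Q.CR * P.Klam ^ 3 * U ^ 2 * 4 := by
      rw [Nat.cast_ofNat]; nlinarith [hcr3]
    have h1 : ∑ i ∈ range n, thermalBar G P U β (i + 1) ≤ 4 / 3 * (G.CF * (P.Klam * U) ^ 2) :=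
      (sum_range_succ_shift_le (f := fun m => thermalBar G P U β m) (fun m => thermalBar_nonneg hCF P U β m) n).trans
        (thermalBar_sum_le hCF P U β hn)
    have h2 : ∑ i ∈ range n, legDressBarQ2 G P Q U (i + 1)
        (legSliceCountT L β μ (klFlowFrameU L M β U μ (i + 1)) (i + 1) ![k', Qm - k', Qm - k, k]) ≤ 20 * (2 * Q.CR * P.Klam ^ 3 * U ^ 2) :=
      ((sum_range_succ_shift_le
          (f := fun m => legDressBarQ2 G P Q U m (legSliceCountT L β μ (klFlowFrameU L M β U μ m) m ![k', Qm - k', Qm - k, k]))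
          (fun m => legDressBarQ2_nonneg G hK0 hCR U m _) n).trans
          (legDressBarQ2_countT_flowFrameU_sum_le L M G hK0 hCR hJ hGfr hU32 _)).trans (by nlinarith [hcr3])
    have h3 : ∑ i ∈ range n, (P.Klam * U) ^ 2 *
        (max (G.phGain (i + 1) (klTorusNorm L (k - k'))) 0 + max (G.phGain (i + 1) (klTorusNorm L (k + k' - Qm))) 0) ≤
        2 * (G.CF * (P.Klam * U) ^ 2) :=
      (sum_range_succ_shift_le
          (f := fun m => (P.Klam * U) ^ 2 * (max (G.phGain m (klTorusNorm L (k - k'))) 0 + max (G.phGain m (klTorusNorm L (k + k' - Qm))) 0))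
          (fun m => klbs9_X_nonneg G P U m _ _) n).trans
        (klbs9_X_sum_le hG P U (n + 1) (torusSupNorm_nonneg _) (torusSupNorm_nonneg _))
    have h4 : ∑ i ∈ range n, frameShiftBar P Q U (i + 1) ≤ 4 / 3 * (Q.CR * P.Klam ^ 3 * U ^ 2) :=
      (sum_range_succ_shift_le (f := fun m => frameShiftBar P Q U m) (fun m => frameShiftBar_nonneg hCR U m) n).trans
        (sum_frameShiftBar_le_cube' hP.1 hCR U (n + 1))
    linarith
  · -- the sign-defect allowance `2·klEdge` is in-class scale-summable (verbatim from p475114)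
    intro L G P Q β U μ t Qm hG hP hQ hU hU1 ht hQt
    have hbhi : 0 ≤ G.bhi := hG.2.2.1.trans hG.2.2.2.1
    have h1 : ∑ i ∈ range t, 2 * klEdge G (i + 1) (klTorusNorm L Qm) =
        2 * G.bhi * ∑ i ∈ range t, min 1 ((2 * (4 : ℝ) ^ 5) * klTorusNorm L Qm * (4 : ℝ) ^ (i + 1)) := by
      rw [mul_sum]
      refine sum_congr rfl fun i _ => ?_
      rw [klEdge_eq_pow, show 2 * klTorusNorm L Qm * (4 : ℝ) ^ (i + 1 + 5) = (2 * (4 : ℝ) ^ 5) * klTorusNorm L Qm * (4 : ℝ) ^ (i + 1) by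
        rw [pow_add]; ring]
      ring
    have h2 : ∑ i ∈ range t, min 1 ((2 * (4 : ℝ) ^ 5) * klTorusNorm L Qm * (4 : ℝ) ^ (i + 1)) ≤ 22 / 3 :=
      (sum_min_one_edge_le (s := 6) (torusSupNorm_nonneg _) (by norm_num) hQt).trans (by norm_num)
    rw [h1]
    refine (mul_le_mul_of_nonneg_left h2 (by positivity : (0 : ℝ) ≤ 2 * G.bhi)).trans ?_
    linarith
  · -- the engine slot yields `EngineBoundsAtV17F2`: project the clauses child 1 reads ((E2-F2): UV / signed ladder; (E2″-F); (E4) at `K_n`; (E5-F))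
    intro L M _ _ G P Q β U μ K n h
    have h' : EngineBoundsAtV17F2 L M G P Q β U μ n := he L M G P Q β U μ K n h
    refine ⟨fun hn0 Qm k hk k' hk' => ?_, fun hn1 Qm hQ => ?_, fun hn1 Qm k hk k' hk' => ?_, h'.2.2.2.2.2.2.1, h'.2.2.2.2.2.2.2⟩
    · rw [if_neg (by omega)]
      exact h'.2.2.1.1 hn0 Qm k hk k' hk'
    · obtain ⟨w, hwabs, hwneg, N, hN, hb⟩ := h'.2.2.1.2 hn1 Qm hQ
      refine ⟨w, hwabs, hwneg, N, hN, fun k hk k' hk' => (hb k hk k' hk').trans ?_⟩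
      rw [if_pos hn1]
      have hx := klbs9_X_le_X G P U n (klTorusNorm L (k - k')) (klTorusNorm L (k + k' - Qm))
      linarith
    · have hx := klbs9_X_nonneg G P U n (klTorusNorm L (k - k')) (klTorusNorm L (k + k' - Qm))
      refine (h'.2.2.2.1 hn1 Qm k hk k' hk').trans ?_
      rw [if_pos hn1]
      linarith

end Model

end Summit.HubbardSuperconductivity.HubbardSuperconductivity.Theorems.KLRegimeSplit

end
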